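import Summits.ValiantsHypothesis.ValiantsHypothesis.Theorems.OrderedCountWindowRungs
import Literature.Computability.AlgebraicComplexity.AndrewsForbes2022BorderLST
import HarnessLib

/-!
# ValiantsHypothesis / DecompCycle1 — the ordered count window HOLDS IN THE BORDER
# (`BORDER = EXACT` for sums of `t` ordered set-multilinear ABPs, `per_n` level, every field)

Workshop `decomp-valiant`, lens 6, generation 29, CALLED offer O5, stage 1 of 2 (stage 2 = the
polynomial face, `OrderedCountWindowBorderPoly.lean`).  `two_pow_le_of_isSumOrdered`
(`OrderedCountWindow.lean`, [ArvindRaja2016, Thm 7/9, Cor 12], constant `2^{⌊⌊n/2⌋/t⌋}`) bounds the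
total width of an EXACT sum of `t` ordered (column-)set-multilinear ABPs for `per_n` in arbitrary
block orders.  Here: the same bound, SAME constant, EVERY field, for `O(ε)`-APPROXIMATE sums —
coefficient tensors `B i` over `F((ε))` of nc-ABP width `≤ w i` there, whose re-ordered sum is
Nisan's `perWord` up to `ε`-order `≥ 1` ((B2) `two_pow_le_of_border`; core at a cut (B1)
`two_pow_le_sum_width_border`); the border twin of the decided `⌊√n⌋` rung, shape `∀ c ∃ n` ((B4)
`border_rung_sqrt`, via the growth form `border_rung_of_not_isPBounded`, which yields the
constant-support rungs the same way); and EXACT ⟹ BORDER ((B3) `border_of_isSumOrdered`).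

MECHANISM (one changed step).  The partition-and-rank proof of `two_pow_le_sum_width` is re-run over
an arbitrary field `K` with its single use of exactness — "the test matrix `(εY, εZ) ↦ ∑_i
B_i(J_{εY,εZ} ∘ σ_i)` has rank `≥ 2^ν`" — turned into a hypothesis
(`two_pow_le_sum_width_of_rankCert`; `testWord_*`, `rank_le_of_prefix_suffix`, `rank_sum_le` are
CALLED; the copied lines are the bookkeeping of the sets `U, Y, Z, T_i` — a DISCLOSED re-run with
the hypothesis weakened, nothing restated as new).  In the border the certificate is RANK
LOWER-SEMICONTINUITY under `ε → 0`: the exact test matrix of `perWord` is `1`, the approximate one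
`1 + O(ε)`, and `rank_F 1 ≤ rank_{F((ε))}(1 + O(ε))` is the tree's
`BorderLST.finrank_span_le_of_isOrdGE` ([AndrewsForbes2022, Lemma 6.2]) through
`Matrix.rank_eq_finrank_span_row` (pattern of `VPBoundarySquareBorderMultilinearFormula`).  For ONE
program border = exact is [BlaserDorflerIkenmeyer2020, Cor 6.7] (tree `BDI2020_cor_6_7_zariski`);
for `t ≥ 2` programs in DIFFERENT orders the summands of a convergent approximate sum may diverge
separately, so only the rank method passes to the border ([Grochow2015Unifying, §3.2]; border of
sums of ROABPs on the PIT side: [BishtSaxena2021]).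

HONEST FRAMING.  Known-in-print-as-remark, kernel-new; a bound for an explicitly restricted class
(few ORDERED set-multilinear ABPs), blind to `per` versus `det`, valid in every characteristic incl.
`2` (where `per_n = det_n ∈ VP`); NOTHING here bears on `VP ≠ VNP`, `VNP ⊄ \overline{VP}` or the
open crux `PerNotSmVP` (stmt 23661).  No new definition, no named fact, no sorry. References:
[ArvindRaja2016] V. Arvind, S. Raja, Chicago J. Theoret. Comput. Sci. 2016, Art. 6 (Thm 7, Thm 9,
Cor 12); [AndrewsForbes2022] R. Andrews, M. A. Forbes, STOC 2022 / arXiv:2112.00792 (Def 2.1, Lemma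
6.2); [BlaserDorflerIkenmeyer2020] M. Bläser, J. Dörfler, C. Ikenmeyer, arXiv:2002.11594 = CCC 2021
(Def 6.1, Cor 6.7); [Grochow2015Unifying] J. A. Grochow, Comput. Complexity 24 (2015),
arXiv:1304.6333, §3.2; [BishtSaxena2021] P. Bisht, N. Saxena, Comput. Complexity 30 (2021), Art. 8.
-/

namespace Summit.ValiantsHypothesis.ValiantsHypothesis.Theorems.OrderedCountWindow

open Literature.Computability.AlgebraicComplexity Matrix

universe u

section RankCert

variable {K : Type*} [Field K]

/-- **Partition-and-rank with a rank certificate** (re-run of `two_pow_le_sum_width` over any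
field `K`, exactness replaced by `hcert`: each test matrix `(εY, εZ) ↦ ∑_i B_i (J_{εY,εZ} ∘ σ_i)`
on disjoint injective `y, z` has rank `≥ 2^ν`). [cite: ArvindRaja2016, Thm 7, Thm 9 (proof)] -/
theorem two_pow_le_sum_width_of_rankCert {a r t : ℕ} (σ : Fin t → Equiv.Perm (Fin (a + r)))
    (w : Fin t → ℕ) (B : Fin t → (Fin (a + r) → Fin (a + r)) → K)
    (hB : ∀ i, BDI2020.HasNcABPWidthLE (w i) (B i))
    (hcert : ∀ (ν : ℕ) (y z : Fin ν → Fin (a + r)), Function.Injective y → Function.Injective z →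
      (∀ j j', y j ≠ z j') → Fintype.card (Fin ν → Bool) ≤
        (Matrix.of fun εY εZ : Fin ν → Bool => ∑ i, B i (testWord y z εY εZ ∘ ⇑(σ i))).rank)
    (ht : 0 < t) (hroom : 2 * (t * r) ≤ a + r) : 2 ^ r ≤ ∑ i, w i := by
  classical
  let L : Fin t → Finset (Fin (a + r)) := fun i =>
    Finset.univ.image fun s : Fin r => σ i (Fin.natAdd a s)
  have hLinj : ∀ i, Function.Injective fun s : Fin r => σ i (Fin.natAdd a s) := by
    intro i s s' h
    simpa [Fin.ext_iff] using (σ i).injective h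
  have hLcard : ∀ i, (L i).card = r := fun i => by
    simp only [L, Finset.card_image_of_injective _ (hLinj i), Finset.card_univ, Fintype.card_fin]
  have hmemL : ∀ i (s : Fin r), σ i (Fin.natAdd a s) ∈ L i := fun i s =>
    Finset.mem_image_of_mem (fun s : Fin r => σ i (Fin.natAdd a s)) (Finset.mem_univ s)
  let U : Finset (Fin (a + r)) := Finset.univ.biUnion L
  have hLU : ∀ i, L i ⊆ U := fun i => Finset.subset_biUnion_of_mem L (Finset.mem_univ i)
  have hU : U.card ≤ t * r :=
    Finset.card_biUnion_le.trans (by simp [hLcard])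
  have hrU : r ≤ U.card := (hLcard ⟨0, ht⟩).symm.le.trans (Finset.card_le_card (hLU _))
  let z : Fin U.card → Fin (a + r) := fun j => U.orderEmbOfFin rfl j
  have hzU : ∀ j, z j ∈ U := fun j => Finset.orderEmbOfFin_mem U rfl j
  have hz : Function.Injective z := (U.orderEmbOfFin rfl).injective
  have hUz : ∀ c ∈ U, ∃ j, z j = c := by
    intro c hc
    exact show c ∈ Set.range (U.orderEmbOfFin rfl) by rw [Finset.range_orderEmbOfFin]; exact hc
  have hcompl : U.card ≤ Uᶜ.card := by rw [Finset.card_compl, Fintype.card_fin]; omega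
  let y : Fin U.card → Fin (a + r) := fun j => Uᶜ.orderEmbOfFin rfl (Fin.castLE hcompl j)
  have hyU : ∀ j, y j ∉ U := fun j => Finset.mem_compl.1 (Finset.orderEmbOfFin_mem Uᶜ rfl _)
  have hy : Function.Injective y :=
    (Uᶜ.orderEmbOfFin rfl).injective.comp (Fin.castLE_injective hcompl)
  have hyz : ∀ j j', y j ≠ z j' := fun j j' h => hyU j (h ▸ hzU j')
  let T : Fin t → Finset (Fin U.card) := fun i => Finset.univ.filter fun j => z j ∈ L i
  have hTcard : ∀ i, (T i).card = r := by
    intro i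
    have himg : (T i).image z = L i := by
      ext c
      simp only [Finset.mem_image, T, Finset.mem_filter, Finset.mem_univ, true_and]
      refine ⟨fun ⟨j, hj, hjc⟩ => hjc ▸ hj, fun hc => ?_⟩
      obtain ⟨j, rfl⟩ := hUz c (hLU i hc)
      exact ⟨j, hc, rfl⟩
    calc (T i).card = ((T i).image z).card := (Finset.card_image_of_injective _ hz).symm
      _ = (L i).card := by rw [himg]
      _ = r := hLcard i
  have hTcompl : ∀ i, (T i)ᶜ.card = U.card - r := fun i => by
    rw [Finset.card_compl, Fintype.card_fin, hTcard]
  let M : Fin t → Matrix (Fin U.card → Bool) (Fin U.card → Bool) K := fun i =>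
    Matrix.of fun εY εZ => B i (testWord y z εY εZ ∘ ⇑(σ i))
  have hSM : (Matrix.of fun εY εZ : Fin U.card → Bool =>
      ∑ i, B i (testWord y z εY εZ ∘ ⇑(σ i))) = ∑ i, M i := by
    ext εY εZ
    simp only [M, Matrix.of_apply, Matrix.sum_apply]
  have hMrank : ∀ i, (M i).rank ≤ 2 ^ (U.card - r) * w i := by
    intro i
    let pre : (Fin U.card → Bool) → (Fin U.card → Bool) → Fin a → Fin (a + r) :=
      fun εY εZ p => testWord y z εY εZ (σ i (Fin.castAdd r p))
    let suf : (Fin U.card → Bool) → Fin r → Fin (a + r) :=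
      fun εZ s => testWord y z (fun _ => false) εZ (σ i (Fin.natAdd a s))
    have hsuf : ∀ εY εZ (s : Fin r), testWord y z εY εZ (σ i (Fin.natAdd a s)) = suf εZ s := by
      intro εY εZ s
      obtain ⟨j, hj⟩ := hUz _ (hLU i (hmemL i s))
      dsimp only [suf]
      rw [← hj, testWord_z hz hyz, testWord_z hz hyz]
    have hword : ∀ εY εZ, testWord y z εY εZ ∘ ⇑(σ i) = Fin.append (pre εY εZ) (suf εZ) := by
      intro εY εZ
      refine funext fun p => Fin.addCases
        (motive := fun p => (testWord y z εY εZ ∘ ⇑(σ i)) p = Fin.append (pre εY εZ) (suf εZ) p)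
        (fun p' => ?_) (fun s => ?_) p
      · simp only [Function.comp_apply, Fin.append_left]
        rfl
      · simp only [Function.comp_apply, Fin.append_right]
        exact hsuf εY εZ s
    have hMi : M i = Matrix.of fun εY εZ => B i (Fin.append (pre εY εZ) (suf εZ)) := by
      ext εY εZ
      simp only [M, Matrix.of_apply, hword]
    have hpre : ∀ εY εZ εZ', (∀ j, j ∉ T i → εZ j = εZ' j) → pre εY εZ = pre εY εZ' := by
      intro εY εZ εZ' hε
      funext p
      dsimp only [pre]
      refine testWord_congr hy hz hyz hε fun j hj hc => ?_
      have hjL : z j ∈ L i := (Finset.mem_filter.1 hj).2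
      obtain ⟨s, -, hs⟩ := Finset.mem_image.1 hjL
      have h' : Fin.natAdd a s = Fin.castAdd r p := (σ i).injective (hs.trans hc)
      have h'' := congrArg Fin.val h'
      have hp := p.isLt
      simp only [Fin.val_natAdd, Fin.val_castAdd] at h''
      omega
    rw [hMi, ← hTcompl i]
    exact rank_le_of_prefix_suffix (hB i) (T i) pre suf hpre
  have hrank : Fintype.card (Fin U.card → Bool) ≤ 2 ^ (U.card - r) * ∑ i, w i := by
    calc Fintype.card (Fin U.card → Bool)
          ≤ (Matrix.of fun εY εZ : Fin U.card → Bool =>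
              ∑ i, B i (testWord y z εY εZ ∘ ⇑(σ i))).rank := hcert _ y z hy hz hyz
      _ = (∑ i, M i).rank := by rw [hSM]
      _ ≤ ∑ i, (M i).rank := rank_sum_le _ _
      _ ≤ ∑ i, 2 ^ (U.card - r) * w i := Finset.sum_le_sum fun i _ => hMrank i
      _ = 2 ^ (U.card - r) * ∑ i, w i := by rw [Finset.mul_sum]
  have hcard : Fintype.card (Fin U.card → Bool) = 2 ^ (U.card - r) * 2 ^ r := by
    rw [← pow_add, Nat.sub_add_cancel hrU]
    simp
  rw [hcard] at hrank
  exact Nat.le_of_mul_le_mul_left hrank (by positivity)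

end RankCert

section Border

variable {F : Type u} [Field F]

/-- **(B1) BORDER core at the cut `a | r`**: tensors `B i` over `F((ε))` of nc-ABP width `≤ w i`
whose re-ordered sum is `perWord + O(ε)` have `∑ w i ≥ 2^r` when `2 t r ≤ a + r` (certificate: the
exact test matrix is `1`, the approximate one `1 + O(ε)`; `BorderLST.finrank_span_le_of_isOrdGE`).
[cite: ArvindRaja2016, Thm 7, Thm 9; AndrewsForbes2022, Lemma 6.2] -/
theorem two_pow_le_sum_width_border (F : Type u) [Field F] (a r t : ℕ)
    (σ : Fin t → Equiv.Perm (Fin (a + r))) (w : Fin t → ℕ)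
    (B : Fin t → (Fin (a + r) → Fin (a + r)) → LaurentSeries F)
    (hB : ∀ i, BDI2020.HasNcABPWidthLE (w i) (B i))
    (hbor : ∀ J, IsOrdGE 1 (∑ i, B i (J ∘ ⇑(σ i)) -
      algebraMap F (LaurentSeries F) (NisanPermanent.perWord F (a + r) J)))
    (ht : 0 < t) (hroom : 2 * (t * r) ≤ a + r) : 2 ^ r ≤ ∑ i, w i := by
  classical
  refine two_pow_le_sum_width_of_rankCert σ w B hB (fun ν y z hy hz hyz => ?_) ht hroom
  let P : Matrix (Fin ν → Bool) (Fin ν → Bool) F :=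
    Matrix.of fun εY εZ => NisanPermanent.perWord F (a + r) (testWord y z εY εZ)
  have hP1 : P = 1 := by
    ext εY εZ
    by_cases h : εY = εZ
    · subst h
      simp [P, NisanPermanent.perWord, testWord_injective_iff hy hz hyz]
    · simp [P, NisanPermanent.perWord, testWord_injective_iff hy hz hyz, h]
  calc Fintype.card (Fin ν → Bool) = P.rank := by rw [hP1, Matrix.rank_one]
    _ ≤ (Matrix.of fun εY εZ : Fin ν → Bool => ∑ i, B i (testWord y z εY εZ ∘ ⇑(σ i))).rank := by
        rw [Matrix.rank_eq_finrank_span_row, Matrix.rank_eq_finrank_span_row]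
        refine BorderLST.finrank_span_le_of_isOrdGE P.row _ fun εY εZ => ?_
        show IsOrdGE 1 ((∑ i, B i (testWord y z εY εZ ∘ ⇑(σ i))) -
          algebraMap F (LaurentSeries F) (NisanPermanent.perWord F (a + r) (testWord y z εY εZ)))
        exact hbor _

/-- **(B2) BORDER Arvind–Raja, exact-world constant, every field**: an `O(ε)`-approximate sum of
`t` ordered set-multilinear ABPs for `per_n`, any block orders, has total width `≥ 2^{⌊⌊n/2⌋/t⌋}`.
[cite: ArvindRaja2016, Thm 7, Thm 9, Cor 12; AndrewsForbes2022, Lemma 6.2] -/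
theorem two_pow_le_of_border (F : Type u) [Field F] (n t W : ℕ) (σ : Fin t → Equiv.Perm (Fin n))
    (w : Fin t → ℕ) (B : Fin t → (Fin n → Fin n) → LaurentSeries F)
    (hB : ∀ i, BDI2020.HasNcABPWidthLE (w i) (B i)) (hsum : ∑ i, w i ≤ W)
    (hbor : ∀ J, IsOrdGE 1 (∑ i, B i (J ∘ ⇑(σ i)) -
      algebraMap F (LaurentSeries F) (NisanPermanent.perWord F n J))) :
    2 ^ (n / 2 / t) ≤ W := by
  have ht : 0 < t := by -- no approximate sum of `0` programs: at `J = id` it reads `-1 = O(ε)`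
    rcases Nat.eq_zero_or_pos t with rfl | ht
    · have h := hbor id 0 zero_lt_one
      simp [NisanPermanent.perWord, Function.injective_id] at h
    · exact ht
  refine le_trans ?_ hsum
  generalize hr : n / 2 / t = r
  have hrn : r ≤ n := by
    rw [← hr]
    exact (Nat.div_le_self _ _).trans (Nat.div_le_self _ _)
  have hroom : 2 * (t * r) ≤ n := by
    rw [← hr]
    calc 2 * (t * (n / 2 / t)) ≤ 2 * (n / 2) := Nat.mul_le_mul_left 2 (Nat.mul_div_le (n / 2) t)
      _ ≤ n := Nat.mul_div_le n 2
  obtain ⟨a, rfl⟩ : ∃ a, a + r = n := ⟨n - r, Nat.sub_add_cancel hrn⟩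
  exact two_pow_le_sum_width_border F a r t σ w B hB hbor ht hroom

/-- Base change of an nc-ABP along `K → L` (map transfer matrices and end vectors). [folklore] -/
theorem hasNcABPWidthLE_algebraMap {K L : Type*} [Field K] [Field L] [Algebra K L] {d m w : ℕ}
    {Ψ : (Fin d → Fin m) → K} (h : BDI2020.HasNcABPWidthLE w Ψ) :
    BDI2020.HasNcABPWidthLE w fun i => algebraMap K L (Ψ i) := by
  obtain ⟨C, u, v, hC⟩ := h
  refine ⟨fun t j => (C t j).map (algebraMap K L), algebraMap K L ∘ u, algebraMap K L ∘ v,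
    fun i => ?_⟩
  change algebraMap K L (Ψ i) =
    algebraMap K L ∘ u ⬝ᵥ ((List.ofFn fun t => (C t (i t)).map (algebraMap K L)).prod *ᵥ
      algebraMap K L ∘ v)
  rw [hC i, RingHom.map_dotProduct]
  congr 1
  funext k
  rw [Function.comp_apply, RingHom.map_mulVec]
  congr 2
  rw [← RingHom.mapMatrix_apply, map_list_prod, List.map_ofFn]
  simp only [Function.comp_def, RingHom.mapMatrix_apply]

/-- **(B3) EXACT ⟹ BORDER**: embed `F ↪ F((ε))`, error `0`, same orders and widths. [folklore] -/
theorem border_of_isSumOrdered (F : Type u) [Field F] (n t W : ℕ) (h : IsSumOrdered F n t W) :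
    ∃ (σ : Fin t → Equiv.Perm (Fin n)) (w : Fin t → ℕ)
      (B : Fin t → (Fin n → Fin n) → LaurentSeries F),
      (∀ i, BDI2020.HasNcABPWidthLE (w i) (B i)) ∧ ∑ i, w i ≤ W ∧
        ∀ J, IsOrdGE 1 (∑ i, B i (J ∘ ⇑(σ i)) -
          algebraMap F (LaurentSeries F) (NisanPermanent.perWord F n J)) := by
  obtain ⟨σ, w, B, hB, hsum, hper⟩ := h
  refine ⟨σ, w, fun i J => algebraMap F (LaurentSeries F) (B i J),
    fun i => hasNcABPWidthLE_algebraMap (hB i), hsum, fun J => ?_⟩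
  rw [← hper J, map_sum, sub_self]
  exact IsOrdGE.zero 1

/-- **Growth form**: `2^{⌊⌊n/2⌋/t(n)⌋}` not p-bounded ⟹ `∀ c ∃ n`, `per_n` is not even
`O(ε)`-approximated by `t(n)` ordered programs of width `n^c + c`. [cite: ArvindRaja2016, Cor 12] -/
theorem border_rung_of_not_isPBounded {t : ℕ → ℕ}
    (h : ¬ IsPBounded fun n => 2 ^ (n / 2 / t n)) (c : ℕ) :
    ∃ n : ℕ, ∀ (σ : Fin (t n) → Equiv.Perm (Fin n)) (w : Fin (t n) → ℕ)
      (B : Fin (t n) → (Fin n → Fin n) → LaurentSeries F),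
      (∀ i, BDI2020.HasNcABPWidthLE (w i) (B i)) → ∑ i, w i ≤ n ^ c + c →
        ¬ ∀ J, IsOrdGE 1 (∑ i, B i (J ∘ ⇑(σ i)) -
          algebraMap F (LaurentSeries F) (NisanPermanent.perWord F n J)) := by
  by_contra hc
  push Not at hc
  refine h ⟨c, fun n => ?_⟩
  obtain ⟨σ, w, B, hB, hsum, hbor⟩ := hc n
  exact two_pow_le_of_border F n (t n) (n ^ c + c) σ w B hB hsum hbor

/-- `2^{⌊⌊n/2⌋/⌊√n⌋⌋}` is not p-bounded (the computation of `perNotSumOrdered_sqrt`). [folklore] -/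
theorem not_isPBounded_window_sqrt : ¬ IsPBounded fun n => 2 ^ (n / 2 / Nat.sqrt n) := by
  intro hP
  have h2 : IsPBounded fun N => 2 * N := IsPBounded.mul_holds (IsPBounded.const 2) IsPBounded.id
  have hsq : IsPBounded fun N => (2 * N) ^ 2 := IsPBounded.pow_holds h2 2
  have hc := IsPBounded.comp_holds hP hsq
  refine not_isPBounded_two_pow (hc.mono fun N => le_of_eq ?_)
  have hN : (2 * N) ^ 2 / 2 / Nat.sqrt ((2 * N) ^ 2) = N := by
    rw [Nat.sqrt_eq']
    rcases Nat.eq_zero_or_pos N with rfl | hN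
    · simp
    · have h1 : (2 * N) ^ 2 / 2 = 2 * N * N := by
        rw [show (2 * N) ^ 2 = 2 * (2 * N * N) by ring]
        exact Nat.mul_div_cancel_left _ (by norm_num)
      rw [h1]
      exact Nat.mul_div_cancel_left N (by omega)
  simp only [hN]

/-- **(B4) the `⌊√n⌋` rung IN THE BORDER, every field** (twin of `perNotSumOrdered_sqrt`; constant
support the same way). [cite: ArvindRaja2016, Cor 12; AndrewsForbes2022, Lemma 6.2] -/
theorem border_rung_sqrt (F : Type u) [Field F] (c : ℕ) :
    ∃ n : ℕ, ∀ (σ : Fin (Nat.sqrt n) → Equiv.Perm (Fin n)) (w : Fin (Nat.sqrt n) → ℕ)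
      (B : Fin (Nat.sqrt n) → (Fin n → Fin n) → LaurentSeries F),
      (∀ i, BDI2020.HasNcABPWidthLE (w i) (B i)) → ∑ i, w i ≤ n ^ c + c →
        ¬ ∀ J, IsOrdGE 1 (∑ i, B i (J ∘ ⇑(σ i)) -
          algebraMap F (LaurentSeries F) (NisanPermanent.perWord F n J)) :=
  border_rung_of_not_isPBounded (t := Nat.sqrt) not_isPBounded_window_sqrt c

end Border
end Summit.ValiantsHypothesis.ValiantsHypothesis.Theorems.OrderedCountWindow
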